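import Mathlib

/-!
# The Jordan block `J₄` (with passengers) has order `p` in every characteristic `p ≥ 5`

(crux stmt-ResolutionOfSingularities-15640 `WildQuotients.WildQuotientResolution`, line `Sketch`,
sector `|G| = p`; programme V4U of `L/w45c/CHAIN.md` v5 — the `|G| = p` input of the cyclic transfer
T1 for the `J₄` final (twin of V3U-A1 `JordanThree.v3_order`, p485170). [OURS · L1 W4.5c] — NOT a
statement of any manuscript; replaces the role of no printed item. Prover res-L1-w45c-stub-4.)

For the `J₄` datum `σ x_b = x_b + x_a`, `σ x_c = x_c + x_b`, `σ x_d = x_d + x_c`, identity on the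
other coordinates: `σᵐ x_b = x_b + m x_a`, `σᵐ x_c = x_c + m x_b + C(m,2) x_a`,
`σᵐ x_d = x_d + m x_c + C(m,2) x_b + C(m,3) x_a`; at `m = p ≥ 5` the coefficients `p`, `C(p,2)`,
`C(p,3)` vanish in characteristic `p` (for `p = 3` the order is `9`, for `p = 2` it is `4`).
-/

-- single-problem summit: the doubled namespace component `ResolutionOfSingularities` is forced
set_option linter.dupNamespace false

noncomputable section

open MvPolynomial

namespace Summit.ResolutionOfSingularities.ResolutionOfSingularities.Theorems.WildQuotientResolution.JordanFour

variable (k : Type) [Field k] (n : ℕ) (σ : MvPolynomial (Fin n) k ≃ₐ[k] MvPolynomial (Fin n) k)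
  (a b c d : Fin n) (hab : a ≠ b) (hac : a ≠ c) (had : a ≠ d)
  (hb : σ (X b) = X b + X a) (hc : σ (X c) = X c + X b) (hd : σ (X d) = X d + X c)
  (hσ : ∀ i, i ≠ b → i ≠ c → i ≠ d → σ (X i) = X i)

/-! ## Iterates -/

include hσ in
/-- `σᵐ xᵢ = xᵢ` for the passenger coordinates `i ≠ b, c, d` (in particular `i = a`). [folklore] -/
theorem pow_apply_X_of_ne (m : ℕ) (i : Fin n) (hib : i ≠ b) (hic : i ≠ c) (hid : i ≠ d) :
    (σ ^ m) (X i) = X i := by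
  induction m with
  | zero => simp
  | succ m ih => rw [pow_succ', AlgEquiv.mul_apply, ih, hσ i hib hic hid]

include hab hac had hb hσ in
/-- `σᵐ x_b = x_b + m x_a`. [folklore] -/
theorem pow_apply_X_b (m : ℕ) :
    (σ ^ m) (X b) = X b + (m : MvPolynomial (Fin n) k) * X a := by
  induction m with
  | zero => simp
  | succ m ih =>
    rw [pow_succ', AlgEquiv.mul_apply, ih, map_add, map_mul, map_natCast, hb, hσ a hab hac had]
    push_cast
    ring

include hab hac had hb hc hσ in
/-- `σᵐ x_c = x_c + m x_b + C(m,2) x_a`. [folklore] -/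
theorem pow_apply_X_c (m : ℕ) :
    (σ ^ m) (X c) = X c + (m : MvPolynomial (Fin n) k) * X b +
      ((m.choose 2 : ℕ) : MvPolynomial (Fin n) k) * X a := by
  induction m with
  | zero => simp
  | succ m ih =>
    rw [pow_succ', AlgEquiv.mul_apply, ih, map_add, map_add, map_mul, map_mul, map_natCast,
      map_natCast, hc, hb, hσ a hab hac had, Nat.choose_succ_succ', Nat.choose_one_right]
    push_cast
    ring

include hab hac had hb hc hd hσ in
/-- `σᵐ x_d = x_d + m x_c + C(m,2) x_b + C(m,3) x_a`. [folklore] -/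
theorem pow_apply_X_d (m : ℕ) :
    (σ ^ m) (X d) = X d + (m : MvPolynomial (Fin n) k) * X c +
      ((m.choose 2 : ℕ) : MvPolynomial (Fin n) k) * X b +
      ((m.choose 3 : ℕ) : MvPolynomial (Fin n) k) * X a := by
  induction m with
  | zero => simp
  | succ m ih =>
    rw [pow_succ', AlgEquiv.mul_apply, ih, map_add, map_add, map_add, map_mul, map_mul, map_mul,
      map_natCast, map_natCast, map_natCast, hd, hc, hb, hσ a hab hac had,
      Nat.choose_succ_succ' m 2, Nat.choose_succ_succ' m 1, Nat.choose_one_right]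
    push_cast
    ring

/-! ## Order -/

include hab hac had hb hc hd hσ in
/-- **`σ ^ p = 1`** for the `J₄` datum in characteristic `p ≥ 5` (`p ∣ C(p,2), C(p,3)`). [folklore] -/
theorem pow_prime_eq_one (p : ℕ) (hp : p.Prime) (hp5 : 5 ≤ p) [CharP k p] : σ ^ p = 1 := by
  classical
  have hp0 : ((p : ℕ) : MvPolynomial (Fin n) k) = 0 := CharP.cast_eq_zero _ p
  have hp2 : (((p : ℕ).choose 2 : ℕ) : MvPolynomial (Fin n) k) = 0 :=
    (CharP.cast_eq_zero_iff (MvPolynomial (Fin n) k) p _).2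
      (hp.dvd_choose_self two_ne_zero (by omega))
  have hp3 : (((p : ℕ).choose 3 : ℕ) : MvPolynomial (Fin n) k) = 0 :=
    (CharP.cast_eq_zero_iff (MvPolynomial (Fin n) k) p _).2
      (hp.dvd_choose_self three_ne_zero (by omega))
  have key : ((σ ^ p : MvPolynomial (Fin n) k ≃ₐ[k] MvPolynomial (Fin n) k) :
      MvPolynomial (Fin n) k →ₐ[k] MvPolynomial (Fin n) k) = AlgHom.id k _ := by
    refine MvPolynomial.algHom_ext fun i => ?_
    change (σ ^ p) (X i) = X i
    by_cases hib : i = b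
    · subst hib
      rw [pow_apply_X_b k n σ a i c d hab hac had hb hσ p, hp0, zero_mul, add_zero]
    by_cases hic : i = c
    · subst hic
      rw [pow_apply_X_c k n σ a b i d hab hac had hb hc hσ p, hp0, hp2, zero_mul, zero_mul,
        add_zero, add_zero]
    by_cases hid : i = d
    · subst hid
      rw [pow_apply_X_d k n σ a b c i hab hac had hb hc hd hσ p, hp0, hp2, hp3, zero_mul, zero_mul,
        zero_mul, add_zero, add_zero, add_zero]
    · exact pow_apply_X_of_ne k n σ b c d hσ p i hib hic hid
  apply AlgEquiv.ext
  intro r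
  have := DFunLike.congr_fun key r
  simpa using this

include hb in
/-- **`σ ≠ 1`** (`σ x_b = x_b + x_a ≠ x_b`). [folklore] -/
theorem ne_one : σ ≠ 1 := by
  intro h
  have h1 := hb
  rw [h, AlgEquiv.one_apply] at h1
  have hX : (X a : MvPolynomial (Fin n) k) = 0 := by
    have := congrArg (fun g => g - X b) h1
    simp only [sub_self, add_sub_cancel_left] at this
    exact this.symm
  exact MvPolynomial.X_ne_zero _ hX

include hab hac had hb hc hd hσ in
/-- **`|⟨σ⟩| = p`** for the `J₄` datum in characteristic `p ≥ 5`. [folklore] -/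
theorem card_zpowers_prime (p : ℕ) (hp : p.Prime) (hp5 : 5 ≤ p) [CharP k p] :
    Nat.card (Subgroup.zpowers σ) = p := by
  haveI : Fact p.Prime := ⟨hp⟩
  rw [Nat.card_zpowers, orderOf_eq_prime (pow_prime_eq_one k n σ a b c d hab hac had hb hc hd hσ p
    hp hp5) (ne_one k n σ a b hb)]

/-- **`v4_order`**: the `J₄` datum `σ x_b = x_b + x_a`, `σ x_c = x_c + x_b`, `σ x_d = x_d + x_c`,
identity on every other coordinate, has `σ ^ p = 1` and `σ ≠ 1` over a field of characteristic
`p ≥ 5` — the `|G| = p` input of the cyclic transfer for the `J₄` final of V4U. Only `a ≠ b, c, d` of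
the six distinctness hypotheses of the law are needed. [OURS · L1 W4.5c] -/
theorem v4_order (p : ℕ) (hp : p.Prime) (hp5 : 5 ≤ p) (k : Type) [Field k] [CharP k p] (n : ℕ)
    (σ : MvPolynomial (Fin n) k ≃ₐ[k] MvPolynomial (Fin n) k) (a b c d : Fin n)
    (hab : a ≠ b) (hac : a ≠ c) (had : a ≠ d)
    (hb : σ (X b) = X b + X a) (hc : σ (X c) = X c + X b) (hd : σ (X d) = X d + X c)
    (hσ : ∀ i, i ≠ b → i ≠ c → i ≠ d → σ (X i) = X i) :
    σ ^ p = 1 ∧ σ ≠ 1 :=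
  ⟨pow_prime_eq_one k n σ a b c d hab hac had hb hc hd hσ p hp hp5, ne_one k n σ a b hb⟩

end Summit.ResolutionOfSingularities.ResolutionOfSingularities.Theorems.WildQuotientResolution.JordanFour

end
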